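/-
Copyright (c) 2026. All rights reserved.
Released under Apache 2.0 license as described in the file LICENSE.
-/
import Literature.Probability.FitznerVanDerHofstad2017.SrwTwistPermSymmetry
import Literature.Probability.FitznerVanDerHofstad2017.SrwWSplitJensen
import Literature.Probability.FitznerVanDerHofstad2017.SrwTwistCosPowRow
import HarnessLib

/-!
# Masses of the product-cosine weight classes are PLAIN SEEDS

Support module (d-generic, number-free, definition-free) for the twisted-seed (`Tw^{w}_n(x;β)`,
`SrwTrigMajorant`) rows of the KU-SEP chain.  Every trigonometric-majorant row
`K ≤ B·Tw^{w}_n(x;0) + c·Sq^{w}_n(x) + Σ_r a_r Tw^{w}_n(x;b_r)` and every `m`-uniform row carries the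
weight MASS `Tw^{w}_n(x;0) = ∫ w Ĉⁿ dk/(2π)^d`; after the class reductions (`SrwTwistWeightClasses`,
`SrwTwistDsinSlices`, `SrwTwistCosPowRow`) the weights are products of coordinate cosines.  This file
proves that such masses are values of the programme's plain SRW integrals `I_{n,l}(x₀)` ((3.35)):

* `srwI_eq_srwTwist_zero` — `I_{n,l}(x₀) = Tw^{D̂^l D̂^{(x₀)}}_n(·;0)` (definitional);
* **`srwTwist_Dhat_pow_mul_prodCos_zero_eq_srwI`** — for `d ≥ 2n+1` and ANY node `x₀ : ℤ^d`,
  `Tw^{D̂^l Π_j cos(x₀_j k_j)}_n(x;0) = I_{n,l}(x₀)`: the symmetrised character `D̂^{(x₀)}` is the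
  `S_d`-average of the coordinate products `Π_j cos(x₀_{νj} k_j)` (`DhatSym_eq_sum_permProd`) and the
  measure `Ĉⁿ dP` is permutation invariant (`srwTwist_weight_comp_perm`);
  `srwTwist_prodCos_zero_eq_srwI` (`l = 0`);
* axis and pair classes: `srwTwist_Dhat_pow_mul_cos_zero_eq_srwI`, `srwTwist_cos_intMul_zero_eq_srwI`
  (`Tw^{cos(m k_i)}_n(x;0) = I_{n,0}(m e_i)`), `srwTwist_cos_zero_eq_srwI`,
  `srwTwist_cos_mul_cos_intMul_zero_eq_srwI` (`Tw^{cos(a k_i) cos(b k_{i'})}_n(x;0) = I_{n,0}(a e_i + b e_{i'})`,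
  `i ≠ i'`), `srwTwist_cos_mul_cos_zero_eq_srwI`;
* the power classes met in the `K_{n,2}`, `U_{n,l}`, `KM₂` rows, by the double/triple-angle formulae:
  `srwTwist_cos_sq_zero_eq` (`(I(0) + I(2e_i))/2`), `srwTwist_sin_sq_zero_eq` (`(I(0) − I(2e_i))/2`),
  `srwTwist_cos_pow_three_zero_eq` (`(3I(e_i) + I(3e_i))/4`), `srwTwist_cos_mul_sin_sq_zero_eq`
  (`(I(e_i) − I(3e_i))/4`), `srwTwist_cos_mul_cos_sq_zero_eq` (`(I(e_i) + I(e_i+2e_{i'}))/2`),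
  `srwTwist_cos_mul_sin_sq_zero_eq'` (`(I(e_i) − I(e_i+2e_{i'}))/2`), `srwTwist_cos_pow_four_zero_eq`
  (`(3I(0) + 4I(2e_i) + I(4e_i))/8`), `srwTwist_sin_pow_four_zero_eq` (`(3I(0) − 4I(2e_i) + I(4e_i))/8`),
  `srwTwist_cos_sq_mul_cos_sq_zero_eq` (`(I(0) + I(2e_i) + I(2e_{i'}) + I(2e_i+2e_{i'}))/4`),
  `srwTwist_sin_sq_mul_sin_sq_zero_eq` (`(I(0) − I(2e_i) − I(2e_{i'}) + I(2e_i+2e_{i'}))/4`);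
* three-index classes (the pure `U_{n,2}` classes): `srwTwist_cos_mul_cos_mul_cos_intMul_zero_eq_srwI`
  (`Tw^{cos(a k_i) cos(b k_{i'}) cos(c k_{i''})}_n(x;0) = I_{n,0}(a e_i + b e_{i'} + c e_{i''})`),
  `srwTwist_cos_pow_three_mul_cos_zero_eq` (`[3,1]`: `(3I(e_i+e_{i'}) + I(3e_i+e_{i'}))/4`),
  `srwTwist_cos_mul_cos_mul_cos_sq_zero_eq` (`[1,1,2]`: `(I(e_i+e_{i'}) + I(e_i+e_{i'}+2e_{i''}))/2`).

So the `B`-terms and the `m`-uniform main terms of the weighted rows are fed by the certified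
plain-seed tables (`I_{n,0}` at the small class nodes), with no Bessel-product row at `β = 0`.

All statements are exact identities for general `d`; nothing here is numerical and nothing is a
certificate.  No dimension-specific declaration is introduced.

References (page and equation numbers refer to the NoBLE companion): [NoBLE17-I] R. Fitzner,
R. van der Hofstad, *Generalized approach to the non-backtracking lace expansion*, Probab. Theory
Relat. Fields 169 (2017) 1041–1119 (bib key `FitznerVanDerHofstad2016NoBLE`), (3.34)–(3.36) p. 1071
(the SRW integrals and the symmetrised character), §5.1.1 (5.2)–(5.5) pp. 1089–1090, §5.2 (5.9), (5.14)
p. 1092 (what the bounds on the weighted integrals are used for); applied in [FvdH17] R. Fitzner,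
R. van der Hofstad, *Mean-field behavior for nearest-neighbor percolation in `d > 10`*, Electron. J.
Probab. 22 (2017) no. 43.
-/

namespace Literature.Probability.FitznerVanDerHofstad2017

open MeasureTheory Real Finset
open Literature.Barriers.CriticalPhenomena
open Literature.Barriers.CriticalPhenomena.Slade2006Prop53 (P)

variable {d : ℕ}

/-! ### The plain seed as a twisted moment at `β = 0` -/

/-- `I_{n,l}(x₀) = Tw^{D̂^l D̂^{(x₀)}}_n(x;0)` (definitional: `cos(0·D̂^{(x)}) = 1`).
[cite: FitznerVanDerHofstad2016NoBLE, (3.34)–(3.35) p. 1071] -/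
theorem srwI_eq_srwTwist_zero (n l : ℕ) (x₀ x : Fin d → ℤ) :
    srwI d n l x₀ = srwTwist d n (fun k => Dhat d k ^ l * DhatSym d x₀ k) x 0 := by
  simp only [srwI, srwTwist, zero_mul, Real.cos_zero, mul_one]

/-- The coordinate product `Π_j cos(x₀_j k_j)` is measurable. [folklore] -/
private theorem measurable_prodCos (x₀ : Fin d → ℤ) :
    Measurable fun k : Fin d → ℝ => ∏ j, Real.cos ((x₀ j : ℝ) * k j) :=
  Finset.measurable_prod _ fun j _ =>
    Real.continuous_cos.measurable.comp (measurable_const.mul (measurable_pi_apply j))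

/-- `|Π_j cos(x₀_j k_j)| ≤ 1`. [folklore] -/
private theorem abs_prodCos_le_one (x₀ : Fin d → ℤ) (k : Fin d → ℝ) :
    |∏ j, Real.cos ((x₀ j : ℝ) * k j)| ≤ 1 := by
  rw [Finset.abs_prod]
  exact Finset.prod_le_one (fun j _ => abs_nonneg _) fun j _ => abs_cos_le_one _

/-- `k ↦ permProd x₀ k ν` is measurable. [folklore] -/
private theorem measurable_permProd (x₀ : Fin d → ℤ) (ν : Equiv.Perm (Fin d)) :
    Measurable fun k : Fin d → ℝ => permProd x₀ k ν := by
  unfold permProd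
  refine Finset.measurable_prod _ fun j _ => ?_
  exact Real.continuous_cos.measurable.comp (measurable_const.mul (measurable_pi_apply j))

/-- `|permProd x₀ k ν| ≤ 1`. [folklore] -/
private theorem abs_permProd_le_one (x₀ : Fin d → ℤ) (k : Fin d → ℝ) (ν : Equiv.Perm (Fin d)) :
    |permProd x₀ k ν| ≤ 1 := by
  unfold permProd
  rw [Finset.abs_prod]
  exact Finset.prod_le_one (fun j _ => abs_nonneg _) fun j _ => abs_cos_le_one _

/-- `permProd x₀ k ν = (Π_j cos(x₀_j ·_j))(k ∘ ν⁻¹)`. [folklore] -/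
private theorem permProd_eq_prodCos_comp (x₀ : Fin d → ℤ) (k : Fin d → ℝ) (ν : Equiv.Perm (Fin d)) :
    permProd x₀ k ν = ∏ j, Real.cos ((x₀ j : ℝ) * (k ∘ ν.symm) j) := by
  rw [permProd_eq_prod_symm]
  rfl

/-- **Product-cosine masses are plain seeds.** For `d ≥ 2n+1` and any node `x₀ : ℤ^d`,
`Tw^{D̂^l Π_j cos(x₀_j k_j)}_n(x;0) = I_{n,l}(x₀)`: `D̂^{(x₀)} = (d!)⁻¹ Σ_ν Π_j cos(x₀_{νj} k_j)`
(`DhatSym_eq_sum_permProd`) and each permuted product has the same mass against the permutation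
invariant `D̂^l Ĉⁿ dP` (`srwTwist_weight_comp_perm`).
[cite: FitznerVanDerHofstad2016NoBLE, (3.34)–(3.35) p. 1071] -/
theorem srwTwist_Dhat_pow_mul_prodCos_zero_eq_srwI {n : ℕ} (hd : 2 * n + 1 ≤ d) (l : ℕ)
    (x₀ x : Fin d → ℤ) :
    srwTwist d n (fun k => Dhat d k ^ l * ∏ j, Real.cos ((x₀ j : ℝ) * k j)) x 0 = srwI d n l x₀ := by
  classical
  rw [srwI_eq_srwTwist_zero n l x₀ x]
  -- expand the symmetrised character over `S_d`
  have hW : (fun k => Dhat d k ^ l * DhatSym d x₀ k)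
      = fun k => ∑ ν : Equiv.Perm (Fin d), (1 / (d.factorial : ℝ)) * (Dhat d k ^ l * permProd x₀ k ν) := by
    funext k
    rw [DhatSym_eq_sum_permProd, Finset.sum_div, Finset.mul_sum]
    exact Finset.sum_congr rfl fun ν _ => by ring
  rw [hW, srwTwist_sum_weight univ (fun _ => 1 / (d.factorial : ℝ))
    (fun ν k => Dhat d k ^ l * permProd x₀ k ν) hd
    (fun ν _ => ((continuous_Dhat d).measurable.pow_const l).mul (measurable_permProd x₀ ν))
    (fun ν _ => ⟨1, fun k => by
      rw [abs_mul, abs_pow]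
      exact mul_le_one₀ (abs_Dhat_pow_le_one l k) (abs_nonneg _) (abs_permProd_le_one x₀ k ν)⟩) x 0]
  -- every permuted product has the mass of the unpermuted one
  have hν : ∀ ν : Equiv.Perm (Fin d),
      srwTwist d n (fun k => Dhat d k ^ l * permProd x₀ k ν) x 0
        = srwTwist d n (fun k => Dhat d k ^ l * ∏ j, Real.cos ((x₀ j : ℝ) * k j)) x 0 := by
    intro ν
    have h := srwTwist_weight_comp_perm (n := n) ν.symm
      (fun k => Dhat d k ^ l * ∏ j, Real.cos ((x₀ j : ℝ) * k j)) x 0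
    rw [← h]
    congr 1
    funext k
    rw [permProd_eq_prodCos_comp, Dhat_comp_perm]
  simp_rw [hν]
  rw [Finset.sum_const, Finset.card_univ, Fintype.card_perm, Fintype.card_fin, nsmul_eq_mul]
  have hf : (d.factorial : ℝ) ≠ 0 := by positivity
  field_simp

/-- `Tw^{Π_j cos(x₀_j k_j)}_n(x;0) = I_{n,0}(x₀)` (`d ≥ 2n+1`).
[cite: FitznerVanDerHofstad2016NoBLE, (3.34)–(3.35) p. 1071] -/
theorem srwTwist_prodCos_zero_eq_srwI {n : ℕ} (hd : 2 * n + 1 ≤ d) (x₀ x : Fin d → ℤ) :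
    srwTwist d n (fun k => ∏ j, Real.cos ((x₀ j : ℝ) * k j)) x 0 = srwI d n 0 x₀ := by
  have h := srwTwist_Dhat_pow_mul_prodCos_zero_eq_srwI hd 0 x₀ x
  simpa only [pow_zero, one_mul] using h

/-! ### Axis and pair classes -/

/-- `Π_j cos((m e_i)_j k_j) = cos(m k_i)`. [folklore] -/
private theorem prodCos_single (i : Fin d) (m : ℤ) (k : Fin d → ℝ) :
    ∏ j, Real.cos (((Pi.single i m : Fin d → ℤ) j : ℝ) * k j) = Real.cos ((m : ℝ) * k i) := by
  rw [Finset.prod_eq_single i (fun j _ hj => by simp [Pi.single_eq_of_ne hj])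
    (fun h => absurd (mem_univ i) h), Pi.single_eq_same]

/-- `Π_j cos((a e_i + b e_{i'})_j k_j) = cos(a k_i) cos(b k_{i'})` (`i ≠ i'`). [folklore] -/
private theorem prodCos_single_add_single {i i' : Fin d} (hii' : i ≠ i') (a b : ℤ) (k : Fin d → ℝ) :
    ∏ j, Real.cos (((Pi.single i a + Pi.single i' b : Fin d → ℤ) j : ℝ) * k j)
      = Real.cos ((a : ℝ) * k i) * Real.cos ((b : ℝ) * k i') := by
  rw [Finset.prod_eq_mul i i' hii']
  · simp [Pi.add_apply, Pi.single_eq_same, Pi.single_eq_of_ne hii', Pi.single_eq_of_ne hii'.symm]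
  · intro c _ hc
    simp [Pi.add_apply, Pi.single_eq_of_ne hc.1, Pi.single_eq_of_ne hc.2]
  · intro h; exact absurd (mem_univ _) h
  · intro h; exact absurd (mem_univ _) h

/-- **Axis class with a `D̂^l` factor**: `Tw^{D̂^l cos(m k_i)}_n(x;0) = I_{n,l}(m e_i)` (`d ≥ 2n+1`).
[cite: FitznerVanDerHofstad2016NoBLE, (3.34)–(3.35) p. 1071] -/
theorem srwTwist_Dhat_pow_mul_cos_zero_eq_srwI {n : ℕ} (hd : 2 * n + 1 ≤ d) (l : ℕ) (i : Fin d)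
    (m : ℤ) (x : Fin d → ℤ) :
    srwTwist d n (fun k => Dhat d k ^ l * Real.cos ((m : ℝ) * k i)) x 0 = srwI d n l (Pi.single i m) := by
  rw [← srwTwist_Dhat_pow_mul_prodCos_zero_eq_srwI hd l (Pi.single i m) x]
  simp_rw [prodCos_single]

/-- **Axis class**: `Tw^{cos(m k_i)}_n(x;0) = I_{n,0}(m e_i)` (`d ≥ 2n+1`).
[cite: FitznerVanDerHofstad2016NoBLE, (3.34)–(3.35) p. 1071] -/
theorem srwTwist_cos_intMul_zero_eq_srwI {n : ℕ} (hd : 2 * n + 1 ≤ d) (i : Fin d) (m : ℤ)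
    (x : Fin d → ℤ) :
    srwTwist d n (fun k => Real.cos ((m : ℝ) * k i)) x 0 = srwI d n 0 (Pi.single i m) := by
  rw [← srwTwist_prodCos_zero_eq_srwI hd (Pi.single i m) x]
  simp_rw [prodCos_single]

/-- `Tw^{cos k_i}_n(x;0) = I_{n,0}(e_i)` (`d ≥ 2n+1`). [cite: FitznerVanDerHofstad2016NoBLE, (3.34)–(3.35) p. 1071] -/
theorem srwTwist_cos_zero_eq_srwI {n : ℕ} (hd : 2 * n + 1 ≤ d) (i : Fin d) (x : Fin d → ℤ) :
    srwTwist d n (fun k => Real.cos (k i)) x 0 = srwI d n 0 (Pi.single i 1) := by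
  have h := srwTwist_cos_intMul_zero_eq_srwI hd i 1 x
  simpa only [Int.cast_one, one_mul] using h

/-- `Tw^{1}_n(x;0) = I_{n,0}(0)` (`d ≥ 2n+1`; from the axis class at `m = 0`). [folklore] -/
private theorem srwTwist_one_zero_eq {n : ℕ} (hd : 2 * n + 1 ≤ d) (i : Fin d) (x : Fin d → ℤ) :
    srwTwist d n (fun _ => (1 : ℝ)) x 0 = srwI d n 0 0 := by
  have h := srwTwist_cos_intMul_zero_eq_srwI hd i 0 x
  simpa only [Int.cast_zero, zero_mul, Real.cos_zero, Pi.single_zero] using h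

/-- **Pair class**: `Tw^{cos(a k_i) cos(b k_{i'})}_n(x;0) = I_{n,0}(a e_i + b e_{i'})` (`i ≠ i'`, `d ≥ 2n+1`).
[cite: FitznerVanDerHofstad2016NoBLE, (3.34)–(3.35) p. 1071] -/
theorem srwTwist_cos_mul_cos_intMul_zero_eq_srwI {n : ℕ} (hd : 2 * n + 1 ≤ d) {i i' : Fin d}
    (hii' : i ≠ i') (a b : ℤ) (x : Fin d → ℤ) :
    srwTwist d n (fun k => Real.cos ((a : ℝ) * k i) * Real.cos ((b : ℝ) * k i')) x 0
      = srwI d n 0 (Pi.single i a + Pi.single i' b) := by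
  have h := srwTwist_prodCos_zero_eq_srwI hd (Pi.single i a + Pi.single i' b) x
  simp_rw [prodCos_single_add_single hii'] at h
  exact h

/-- `Tw^{cos k_i cos k_{i'}}_n(x;0) = I_{n,0}(e_i + e_{i'})` (`i ≠ i'`, `d ≥ 2n+1`).
[cite: FitznerVanDerHofstad2016NoBLE, (3.34)–(3.35) p. 1071] -/
theorem srwTwist_cos_mul_cos_zero_eq_srwI {n : ℕ} (hd : 2 * n + 1 ≤ d) {i i' : Fin d} (hii' : i ≠ i')
    (x : Fin d → ℤ) :
    srwTwist d n (fun k => Real.cos (k i) * Real.cos (k i')) x 0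
      = srwI d n 0 (Pi.single i 1 + Pi.single i' 1) := by
  have h := srwTwist_cos_mul_cos_intMul_zero_eq_srwI hd hii' 1 1 x
  simpa only [Int.cast_one, one_mul] using h

/-! ### Power classes by multiple-angle formulae -/

/-- Two-term linearity of `Tw` for bounded measurable weights. [folklore] -/
private theorem srwTwist_lin₂ {n : ℕ} (hd : 2 * n + 1 ≤ d) (c₁ c₂ : ℝ) (w₁ w₂ : (Fin d → ℝ) → ℝ)
    (h₁ : Measurable w₁) (h₂ : Measurable w₂) {W₁ W₂ : ℝ} (hb₁ : ∀ k, |w₁ k| ≤ W₁)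
    (hb₂ : ∀ k, |w₂ k| ≤ W₂) (x : Fin d → ℤ) (β : ℝ) :
    srwTwist d n (fun k => c₁ * w₁ k + c₂ * w₂ k) x β
      = c₁ * srwTwist d n w₁ x β + c₂ * srwTwist d n w₂ x β := by
  rw [srwTwist_add_weight (fun k => c₁ * w₁ k) (fun k => c₂ * w₂ k) x β, srwTwist_const_mul_weight,
    srwTwist_const_mul_weight]
  · exact integrable_weight_cos_mul_Chat_pow hd (w := fun k => c₁ * w₁ k) (measurable_const.mul h₁)
      (W := |c₁| * W₁) (fun k => by rw [abs_mul]; exact mul_le_mul_of_nonneg_left (hb₁ k) (abs_nonneg _)) x β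
  · exact integrable_weight_cos_mul_Chat_pow hd (w := fun k => c₂ * w₂ k) (measurable_const.mul h₂)
      (W := |c₂| * W₂) (fun k => by rw [abs_mul]; exact mul_le_mul_of_nonneg_left (hb₂ k) (abs_nonneg _)) x β

/-- `k ↦ cos(c k_i)` is measurable. [folklore] -/
private theorem measurable_cos_cmul (c : ℝ) (i : Fin d) :
    Measurable fun k : Fin d → ℝ => Real.cos (c * k i) :=
  Real.continuous_cos.measurable.comp (measurable_const.mul (measurable_pi_apply i))

/-- `|cos(a) cos(b)| ≤ 1`. [folklore] -/
private theorem abs_cos_mul_cos_le (a b : ℝ) : |Real.cos a * Real.cos b| ≤ 1 := by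
  rw [abs_mul]; exact mul_le_one₀ (abs_cos_le_one _) (abs_nonneg _) (abs_cos_le_one _)

/-- `|cos(a) cos(b)^2| ≤ 1`. [folklore] -/
private theorem abs_cos_mul_cos_sq_le (a b : ℝ) : |Real.cos a * Real.cos b ^ 2| ≤ 1 := by
  rw [abs_mul, abs_pow]
  exact mul_le_one₀ (abs_cos_le_one _) (pow_nonneg (abs_nonneg _) 2)
    (pow_le_one₀ (abs_nonneg _) (abs_cos_le_one _))

/-- `|cos² a cos² b| ≤ 1`. [folklore] -/
private theorem abs_cos_sq_mul_cos_sq_le (a b : ℝ) : |Real.cos a ^ 2 * Real.cos b ^ 2| ≤ 1 := by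
  rw [abs_mul, abs_pow, abs_pow]
  exact mul_le_one₀ (pow_le_one₀ (abs_nonneg _) (abs_cos_le_one _)) (pow_nonneg (abs_nonneg _) 2)
    (pow_le_one₀ (abs_nonneg _) (abs_cos_le_one _))

/-- `cos⁴ t = ⅜ + ½ cos 2t + ⅛ cos 4t`. [folklore] -/
private theorem cos_pow_four_eq (t : ℝ) :
    Real.cos t ^ 4 = 3 / 8 + Real.cos (2 * t) / 2 + Real.cos (4 * t) / 8 := by
  have h1 : Real.cos t ^ 2 = 1 / 2 + Real.cos (2 * t) / 2 := Real.cos_sq t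
  have h2 : Real.cos (2 * t) ^ 2 = 1 / 2 + Real.cos (4 * t) / 2 := by
    rw [Real.cos_sq, show (2 : ℝ) * (2 * t) = 4 * t by ring]
  linear_combination (Real.cos t ^ 2 + 1 / 2 + Real.cos (2 * t) / 2) * h1 + (1 / 4 : ℝ) * h2

/-- **`[2]`-power class**: `Tw^{cos² k_i}_n(x;0) = (I_{n,0}(0) + I_{n,0}(2e_i))/2` (`d ≥ 2n+1`).
[cite: FitznerVanDerHofstad2016NoBLE, (3.34)–(3.35) p. 1071, §5.2 (5.9) p. 1092] -/
theorem srwTwist_cos_sq_zero_eq {n : ℕ} (hd : 2 * n + 1 ≤ d) (i : Fin d) (x : Fin d → ℤ) :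
    srwTwist d n (fun k => Real.cos (k i) ^ 2) x 0 = (srwI d n 0 0 + srwI d n 0 (Pi.single i 2)) / 2 := by
  have hw : (fun k : Fin d → ℝ => Real.cos (k i) ^ 2)
      = fun k => 1 / 2 * (1 : ℝ) + 1 / 2 * Real.cos ((2 : ℝ) * k i) := by
    funext k; rw [Real.cos_sq]; ring
  have h2 := srwTwist_cos_intMul_zero_eq_srwI hd i 2 x
  simp only [Int.cast_ofNat] at h2
  rw [hw, srwTwist_lin₂ hd _ _ (fun _ => (1 : ℝ)) (fun k => Real.cos ((2 : ℝ) * k i)) measurable_const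
    (measurable_cos_cmul 2 i) (W₁ := 1) (W₂ := 1) (fun _ => by rw [abs_one]) (fun _ => abs_cos_le_one _),
    srwTwist_one_zero_eq hd i x, h2]
  ring

/-- `Tw^{sin² k_i}_n(x;0) = (I_{n,0}(0) − I_{n,0}(2e_i))/2` (`d ≥ 2n+1`).
[cite: FitznerVanDerHofstad2016NoBLE, (3.34)–(3.35) p. 1071, §5.1.1 (5.2)] -/
theorem srwTwist_sin_sq_zero_eq {n : ℕ} (hd : 2 * n + 1 ≤ d) (i : Fin d) (x : Fin d → ℤ) :
    srwTwist d n (fun k => Real.sin (k i) ^ 2) x 0 = (srwI d n 0 0 - srwI d n 0 (Pi.single i 2)) / 2 := by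
  have hw : (fun k : Fin d → ℝ => Real.sin (k i) ^ 2)
      = fun k => 1 / 2 * (1 : ℝ) + (-(1 / 2)) * Real.cos ((2 : ℝ) * k i) := by
    funext k; rw [Real.sin_sq, Real.cos_sq]; ring
  have h2 := srwTwist_cos_intMul_zero_eq_srwI hd i 2 x
  simp only [Int.cast_ofNat] at h2
  rw [hw, srwTwist_lin₂ hd _ _ (fun _ => (1 : ℝ)) (fun k => Real.cos ((2 : ℝ) * k i)) measurable_const
    (measurable_cos_cmul 2 i) (W₁ := 1) (W₂ := 1) (fun _ => by rw [abs_one]) (fun _ => abs_cos_le_one _),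
    srwTwist_one_zero_eq hd i x, h2]
  ring

/-- **`[3]`-power class**: `Tw^{cos³ k_i}_n(x;0) = (3 I_{n,0}(e_i) + I_{n,0}(3e_i))/4` (`d ≥ 2n+1`).
[cite: FitznerVanDerHofstad2016NoBLE, (3.34)–(3.35) p. 1071, §5.2 (5.9) p. 1092] -/
theorem srwTwist_cos_pow_three_zero_eq {n : ℕ} (hd : 2 * n + 1 ≤ d) (i : Fin d) (x : Fin d → ℤ) :
    srwTwist d n (fun k => Real.cos (k i) ^ 3) x 0
      = (3 * srwI d n 0 (Pi.single i 1) + srwI d n 0 (Pi.single i 3)) / 4 := by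
  have hw : (fun k : Fin d → ℝ => Real.cos (k i) ^ 3)
      = fun k => 3 / 4 * Real.cos (k i) + 1 / 4 * Real.cos ((3 : ℝ) * k i) := by
    funext k; rw [Real.cos_three_mul]; ring
  have h3 := srwTwist_cos_intMul_zero_eq_srwI hd i 3 x
  simp only [Int.cast_ofNat] at h3
  rw [hw, srwTwist_lin₂ hd _ _ (fun k => Real.cos (k i)) (fun k => Real.cos ((3 : ℝ) * k i))
    (Real.continuous_cos.measurable.comp (measurable_pi_apply i)) (measurable_cos_cmul 3 i) (W₁ := 1)
    (W₂ := 1) (fun _ => abs_cos_le_one _) (fun _ => abs_cos_le_one _), srwTwist_cos_zero_eq_srwI hd i x, h3]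
  ring

/-- `Tw^{cos k_i sin² k_i}_n(x;0) = (I_{n,0}(e_i) − I_{n,0}(3e_i))/4` (`d ≥ 2n+1`; the diagonal class of the
`D̂ D̂^{sin}` weight of `KM₂`). [cite: FitznerVanDerHofstad2016NoBLE, (3.34)–(3.35) p. 1071, §5.2 (5.14) p. 1092] -/
theorem srwTwist_cos_mul_sin_sq_zero_eq {n : ℕ} (hd : 2 * n + 1 ≤ d) (i : Fin d) (x : Fin d → ℤ) :
    srwTwist d n (fun k => Real.cos (k i) * Real.sin (k i) ^ 2) x 0
      = (srwI d n 0 (Pi.single i 1) - srwI d n 0 (Pi.single i 3)) / 4 := by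
  have hw : (fun k : Fin d → ℝ => Real.cos (k i) * Real.sin (k i) ^ 2)
      = fun k => 1 / 4 * Real.cos (k i) + (-(1 / 4)) * Real.cos ((3 : ℝ) * k i) := by
    funext k; rw [Real.sin_sq, Real.cos_three_mul]; ring
  have h3 := srwTwist_cos_intMul_zero_eq_srwI hd i 3 x
  simp only [Int.cast_ofNat] at h3
  rw [hw, srwTwist_lin₂ hd _ _ (fun k => Real.cos (k i)) (fun k => Real.cos ((3 : ℝ) * k i))
    (Real.continuous_cos.measurable.comp (measurable_pi_apply i)) (measurable_cos_cmul 3 i) (W₁ := 1)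
    (W₂ := 1) (fun _ => abs_cos_le_one _) (fun _ => abs_cos_le_one _), srwTwist_cos_zero_eq_srwI hd i x, h3]
  ring

/-- **Mixed `[1,2]` class**: `Tw^{cos k_i cos² k_{i'}}_n(x;0) = (I_{n,0}(e_i) + I_{n,0}(e_i + 2e_{i'}))/2`
(`i ≠ i'`, `d ≥ 2n+1`). [cite: FitznerVanDerHofstad2016NoBLE, (3.34)–(3.35) p. 1071, §5.2 (5.9) p. 1092] -/
theorem srwTwist_cos_mul_cos_sq_zero_eq {n : ℕ} (hd : 2 * n + 1 ≤ d) {i i' : Fin d} (hii' : i ≠ i')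
    (x : Fin d → ℤ) :
    srwTwist d n (fun k => Real.cos (k i) * Real.cos (k i') ^ 2) x 0
      = (srwI d n 0 (Pi.single i 1) + srwI d n 0 (Pi.single i 1 + Pi.single i' 2)) / 2 := by
  have hw : (fun k : Fin d → ℝ => Real.cos (k i) * Real.cos (k i') ^ 2)
      = fun k => 1 / 2 * Real.cos (k i) + 1 / 2 * (Real.cos ((1 : ℝ) * k i) * Real.cos ((2 : ℝ) * k i')) := by
    funext k; rw [Real.cos_sq, one_mul]; ring
  have h12 := srwTwist_cos_mul_cos_intMul_zero_eq_srwI hd hii' 1 2 x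
  simp only [Int.cast_ofNat, Int.cast_one] at h12
  rw [hw, srwTwist_lin₂ hd _ _ (fun k => Real.cos (k i))
    (fun k => Real.cos ((1 : ℝ) * k i) * Real.cos ((2 : ℝ) * k i'))
    (Real.continuous_cos.measurable.comp (measurable_pi_apply i))
    ((measurable_cos_cmul 1 i).mul (measurable_cos_cmul 2 i')) (W₁ := 1) (W₂ := 1)
    (fun _ => abs_cos_le_one _) (fun _ => abs_cos_mul_cos_le _ _), srwTwist_cos_zero_eq_srwI hd i x, h12]
  ring

/-- `Tw^{cos k_i sin² k_{i'}}_n(x;0) = (I_{n,0}(e_i) − I_{n,0}(e_i + 2e_{i'}))/2` (`i ≠ i'`, `d ≥ 2n+1`; the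
off-diagonal class of the `D̂ D̂^{sin}` weight of `KM₂`).
[cite: FitznerVanDerHofstad2016NoBLE, (3.34)–(3.35) p. 1071, §5.2 (5.14) p. 1092] -/
theorem srwTwist_cos_mul_sin_sq_zero_eq' {n : ℕ} (hd : 2 * n + 1 ≤ d) {i i' : Fin d} (hii' : i ≠ i')
    (x : Fin d → ℤ) :
    srwTwist d n (fun k => Real.cos (k i) * Real.sin (k i') ^ 2) x 0
      = (srwI d n 0 (Pi.single i 1) - srwI d n 0 (Pi.single i 1 + Pi.single i' 2)) / 2 := by
  have hw : (fun k : Fin d → ℝ => Real.cos (k i) * Real.sin (k i') ^ 2)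
      = fun k => 1 / 2 * Real.cos (k i)
          + (-(1 / 2)) * (Real.cos ((1 : ℝ) * k i) * Real.cos ((2 : ℝ) * k i')) := by
    funext k; rw [Real.sin_sq, Real.cos_sq, one_mul]; ring
  have h12 := srwTwist_cos_mul_cos_intMul_zero_eq_srwI hd hii' 1 2 x
  simp only [Int.cast_ofNat, Int.cast_one] at h12
  rw [hw, srwTwist_lin₂ hd _ _ (fun k => Real.cos (k i))
    (fun k => Real.cos ((1 : ℝ) * k i) * Real.cos ((2 : ℝ) * k i'))
    (Real.continuous_cos.measurable.comp (measurable_pi_apply i))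
    ((measurable_cos_cmul 1 i).mul (measurable_cos_cmul 2 i')) (W₁ := 1) (W₂ := 1)
    (fun _ => abs_cos_le_one _) (fun _ => abs_cos_mul_cos_le _ _), srwTwist_cos_zero_eq_srwI hd i x, h12]
  ring

/-- **`[4]`-power class**: `Tw^{cos⁴ k_i}_n(x;0) = (3 I_{n,0}(0) + 4 I_{n,0}(2e_i) + I_{n,0}(4e_i))/8`
(`d ≥ 2n+1`). [cite: FitznerVanDerHofstad2016NoBLE, (3.34)–(3.35) p. 1071, §5.2 (5.9) p. 1092] -/
theorem srwTwist_cos_pow_four_zero_eq {n : ℕ} (hd : 2 * n + 1 ≤ d) (i : Fin d) (x : Fin d → ℤ) :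
    srwTwist d n (fun k => Real.cos (k i) ^ 4) x 0
      = (3 * srwI d n 0 0 + 4 * srwI d n 0 (Pi.single i 2) + srwI d n 0 (Pi.single i 4)) / 8 := by
  -- `cos⁴ = (3/8 + cos 2t/2) + cos 4t/8`, in two linear steps
  have hw : (fun k : Fin d → ℝ => Real.cos (k i) ^ 4)
      = fun k => (1 : ℝ) * (3 / 8 * (1 : ℝ) + 1 / 2 * Real.cos ((2 : ℝ) * k i))
          + 1 / 8 * Real.cos ((4 : ℝ) * k i) := by
    funext k; rw [cos_pow_four_eq]; ring
  have hm : Measurable fun k : Fin d → ℝ => 3 / 8 * (1 : ℝ) + 1 / 2 * Real.cos ((2 : ℝ) * k i) :=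
    measurable_const.add (measurable_const.mul (measurable_cos_cmul 2 i))
  have hb : ∀ k : Fin d → ℝ, |3 / 8 * (1 : ℝ) + 1 / 2 * Real.cos ((2 : ℝ) * k i)| ≤ 1 := by
    intro k
    have := abs_cos_le_one (2 * k i)
    rw [abs_le] at this ⊢
    constructor <;> linarith [this.1, this.2]
  have h2 := srwTwist_cos_intMul_zero_eq_srwI hd i 2 x
  have h4 := srwTwist_cos_intMul_zero_eq_srwI hd i 4 x
  simp only [Int.cast_ofNat] at h2 h4
  rw [hw, srwTwist_lin₂ hd _ _ (fun k => 3 / 8 * (1 : ℝ) + 1 / 2 * Real.cos ((2 : ℝ) * k i))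
    (fun k => Real.cos ((4 : ℝ) * k i)) hm (measurable_cos_cmul 4 i) (W₂ := 1) hb (fun _ => abs_cos_le_one _),
    srwTwist_lin₂ hd _ _ (fun _ => (1 : ℝ)) (fun k => Real.cos ((2 : ℝ) * k i)) measurable_const
    (measurable_cos_cmul 2 i) (W₁ := 1) (W₂ := 1) (fun _ => by rw [abs_one]) (fun _ => abs_cos_le_one _),
    srwTwist_one_zero_eq hd i x, h2, h4]
  ring

/-- `Tw^{sin⁴ k_i}_n(x;0) = (3 I_{n,0}(0) − 4 I_{n,0}(2e_i) + I_{n,0}(4e_i))/8` (`d ≥ 2n+1`; the diagonal class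
of the `(D̂^{sin})²` weight of `KM₂`). [cite: FitznerVanDerHofstad2016NoBLE, (3.34)–(3.35) p. 1071, §5.2 (5.14) p. 1092] -/
theorem srwTwist_sin_pow_four_zero_eq {n : ℕ} (hd : 2 * n + 1 ≤ d) (i : Fin d) (x : Fin d → ℤ) :
    srwTwist d n (fun k => Real.sin (k i) ^ 4) x 0
      = (3 * srwI d n 0 0 - 4 * srwI d n 0 (Pi.single i 2) + srwI d n 0 (Pi.single i 4)) / 8 := by
  have hw : (fun k : Fin d → ℝ => Real.sin (k i) ^ 4)
      = fun k => (1 : ℝ) * (3 / 8 * (1 : ℝ) + (-(1 / 2)) * Real.cos ((2 : ℝ) * k i))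
          + 1 / 8 * Real.cos ((4 : ℝ) * k i) := by
    funext k
    rw [show Real.sin (k i) ^ 4 = (Real.sin (k i) ^ 2) ^ 2 by ring, Real.sin_sq,
      show ((1 : ℝ) - Real.cos (k i) ^ 2) ^ 2 = 1 - 2 * Real.cos (k i) ^ 2 + Real.cos (k i) ^ 4 by ring,
      cos_pow_four_eq, Real.cos_sq]
    ring
  have hm : Measurable fun k : Fin d → ℝ => 3 / 8 * (1 : ℝ) + (-(1 / 2)) * Real.cos ((2 : ℝ) * k i) :=
    measurable_const.add (measurable_const.mul (measurable_cos_cmul 2 i))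
  have hb : ∀ k : Fin d → ℝ, |3 / 8 * (1 : ℝ) + (-(1 / 2)) * Real.cos ((2 : ℝ) * k i)| ≤ 1 := by
    intro k
    have := abs_cos_le_one (2 * k i)
    rw [abs_le] at this ⊢
    constructor <;> linarith [this.1, this.2]
  have h2 := srwTwist_cos_intMul_zero_eq_srwI hd i 2 x
  have h4 := srwTwist_cos_intMul_zero_eq_srwI hd i 4 x
  simp only [Int.cast_ofNat] at h2 h4
  rw [hw, srwTwist_lin₂ hd _ _ (fun k => 3 / 8 * (1 : ℝ) + (-(1 / 2)) * Real.cos ((2 : ℝ) * k i))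
    (fun k => Real.cos ((4 : ℝ) * k i)) hm (measurable_cos_cmul 4 i) (W₂ := 1) hb (fun _ => abs_cos_le_one _),
    srwTwist_lin₂ hd _ _ (fun _ => (1 : ℝ)) (fun k => Real.cos ((2 : ℝ) * k i)) measurable_const
    (measurable_cos_cmul 2 i) (W₁ := 1) (W₂ := 1) (fun _ => by rw [abs_one]) (fun _ => abs_cos_le_one _),
    srwTwist_one_zero_eq hd i x, h2, h4]
  ring

/-- `Tw^{cos(2k_i) cos² k_{i'}}_n(x;0) = (I_{n,0}(2e_i) + I_{n,0}(2e_i + 2e_{i'}))/2` (`i ≠ i'`). [folklore] -/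
private theorem srwTwist_cos_two_mul_cos_sq_zero_eq {n : ℕ} (hd : 2 * n + 1 ≤ d) {i i' : Fin d}
    (hii' : i ≠ i') (x : Fin d → ℤ) :
    srwTwist d n (fun k => Real.cos ((2 : ℝ) * k i) * Real.cos (k i') ^ 2) x 0
      = (srwI d n 0 (Pi.single i 2) + srwI d n 0 (Pi.single i 2 + Pi.single i' 2)) / 2 := by
  have hw : (fun k : Fin d → ℝ => Real.cos ((2 : ℝ) * k i) * Real.cos (k i') ^ 2)
      = fun k => 1 / 2 * Real.cos ((2 : ℝ) * k i)
          + 1 / 2 * (Real.cos ((2 : ℝ) * k i) * Real.cos ((2 : ℝ) * k i')) := by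
    funext k; rw [Real.cos_sq]; ring
  have h2 := srwTwist_cos_intMul_zero_eq_srwI hd i 2 x
  have h22 := srwTwist_cos_mul_cos_intMul_zero_eq_srwI hd hii' 2 2 x
  simp only [Int.cast_ofNat] at h2 h22
  rw [hw, srwTwist_lin₂ hd _ _ (fun k => Real.cos ((2 : ℝ) * k i))
    (fun k => Real.cos ((2 : ℝ) * k i) * Real.cos ((2 : ℝ) * k i')) (measurable_cos_cmul 2 i)
    ((measurable_cos_cmul 2 i).mul (measurable_cos_cmul 2 i')) (W₁ := 1) (W₂ := 1)
    (fun _ => abs_cos_le_one _) (fun _ => abs_cos_mul_cos_le _ _), h2, h22]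
  ring

/-- **`[2,2]`-power class**: `Tw^{cos² k_i cos² k_{i'}}_n(x;0) = (I_{n,0}(0) + I_{n,0}(2e_i) + I_{n,0}(2e_{i'}) + I_{n,0}(2e_i + 2e_{i'}))/4`
(`i ≠ i'`, `d ≥ 2n+1`; `I_{n,0}(2e_{i'}) = I_{n,0}(2e_i)` by the lattice symmetry, not used here).
[cite: FitznerVanDerHofstad2016NoBLE, (3.34)–(3.35) p. 1071, §5.2 (5.9) p. 1092] -/
theorem srwTwist_cos_sq_mul_cos_sq_zero_eq {n : ℕ} (hd : 2 * n + 1 ≤ d) {i i' : Fin d} (hii' : i ≠ i')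
    (x : Fin d → ℤ) :
    srwTwist d n (fun k => Real.cos (k i) ^ 2 * Real.cos (k i') ^ 2) x 0
      = (srwI d n 0 0 + srwI d n 0 (Pi.single i 2) + srwI d n 0 (Pi.single i' 2)
          + srwI d n 0 (Pi.single i 2 + Pi.single i' 2)) / 4 := by
  have hw : (fun k : Fin d → ℝ => Real.cos (k i) ^ 2 * Real.cos (k i') ^ 2)
      = fun k => 1 / 2 * Real.cos (k i') ^ 2 + 1 / 2 * (Real.cos ((2 : ℝ) * k i) * Real.cos (k i') ^ 2) := by
    funext k; rw [Real.cos_sq (k i)]; ring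
  rw [hw, srwTwist_lin₂ hd _ _ (fun k => Real.cos (k i') ^ 2)
    (fun k => Real.cos ((2 : ℝ) * k i) * Real.cos (k i') ^ 2)
    ((Real.continuous_cos.measurable.comp (measurable_pi_apply i')).pow_const 2)
    ((measurable_cos_cmul 2 i).mul ((Real.continuous_cos.measurable.comp (measurable_pi_apply i')).pow_const 2))
    (W₁ := 1) (W₂ := 1) (fun k => by rw [abs_pow]; exact pow_le_one₀ (abs_nonneg _) (abs_cos_le_one _))
    (fun _ => abs_cos_mul_cos_sq_le _ _), srwTwist_cos_sq_zero_eq hd i' x,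
    srwTwist_cos_two_mul_cos_sq_zero_eq hd hii' x]
  ring

/-- `Tw^{sin² k_i sin² k_{i'}}_n(x;0) = (I_{n,0}(0) − I_{n,0}(2e_i) − I_{n,0}(2e_{i'}) + I_{n,0}(2e_i + 2e_{i'}))/4`
(`i ≠ i'`, `d ≥ 2n+1`; the off-diagonal class of the `(D̂^{sin})²` weight of `KM₂`).
[cite: FitznerVanDerHofstad2016NoBLE, (3.34)–(3.35) p. 1071, §5.2 (5.14) p. 1092] -/
theorem srwTwist_sin_sq_mul_sin_sq_zero_eq {n : ℕ} (hd : 2 * n + 1 ≤ d) {i i' : Fin d} (hii' : i ≠ i')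
    (x : Fin d → ℤ) :
    srwTwist d n (fun k => Real.sin (k i) ^ 2 * Real.sin (k i') ^ 2) x 0
      = (srwI d n 0 0 - srwI d n 0 (Pi.single i 2) - srwI d n 0 (Pi.single i' 2)
          + srwI d n 0 (Pi.single i 2 + Pi.single i' 2)) / 4 := by
  -- `sin² a sin² b = sin² b − cos² a sin² b`... written as `(1 − cos² b) − (cos² a − cos² a cos² b)`
  have hw : (fun k : Fin d → ℝ => Real.sin (k i) ^ 2 * Real.sin (k i') ^ 2)
      = fun k => (1 : ℝ) * (1 * (1 : ℝ) + (-1) * Real.cos (k i') ^ 2)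
          + (-1) * (1 * Real.cos (k i) ^ 2 + (-1) * (Real.cos (k i) ^ 2 * Real.cos (k i') ^ 2)) := by
    funext k; rw [Real.sin_sq, Real.sin_sq]; ring
  have hci : Measurable fun k : Fin d → ℝ => Real.cos (k i) ^ 2 :=
    (Real.continuous_cos.measurable.comp (measurable_pi_apply i)).pow_const 2
  have hci' : Measurable fun k : Fin d → ℝ => Real.cos (k i') ^ 2 :=
    (Real.continuous_cos.measurable.comp (measurable_pi_apply i')).pow_const 2
  have hbsq : ∀ (j : Fin d) (k : Fin d → ℝ), |Real.cos (k j) ^ 2| ≤ 1 := fun j k => by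
    rw [abs_pow]; exact pow_le_one₀ (abs_nonneg _) (abs_cos_le_one _)
  have hm₁ : Measurable fun k : Fin d → ℝ => 1 * (1 : ℝ) + (-1) * Real.cos (k i') ^ 2 :=
    measurable_const.add (measurable_const.mul hci')
  have hm₂ : Measurable fun k : Fin d → ℝ => 1 * Real.cos (k i) ^ 2 + (-1) * (Real.cos (k i) ^ 2 * Real.cos (k i') ^ 2) :=
    (measurable_const.mul hci).add (measurable_const.mul (hci.mul hci'))
  have hb₁ : ∀ k : Fin d → ℝ, |1 * (1 : ℝ) + (-1) * Real.cos (k i') ^ 2| ≤ 1 := by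
    intro k
    have h0 : 0 ≤ Real.cos (k i') ^ 2 := sq_nonneg _
    have h1 : Real.cos (k i') ^ 2 ≤ 1 := by rw [← abs_of_nonneg h0]; exact hbsq i' k
    rw [abs_le]; constructor <;> nlinarith
  have hb₂ : ∀ k : Fin d → ℝ, |1 * Real.cos (k i) ^ 2 + (-1) * (Real.cos (k i) ^ 2 * Real.cos (k i') ^ 2)| ≤ 1 := by
    intro k
    have h0 : 0 ≤ Real.cos (k i) ^ 2 := sq_nonneg _
    have h1 : Real.cos (k i) ^ 2 ≤ 1 := by rw [← abs_of_nonneg h0]; exact hbsq i k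
    have h0' : 0 ≤ Real.cos (k i') ^ 2 := sq_nonneg _
    have h1' : Real.cos (k i') ^ 2 ≤ 1 := by rw [← abs_of_nonneg h0']; exact hbsq i' k
    rw [abs_le]; constructor <;> nlinarith [mul_nonneg h0 h0', mul_le_mul h1 h1' h0' zero_le_one]
  rw [hw, srwTwist_lin₂ hd _ _ (fun k => 1 * (1 : ℝ) + (-1) * Real.cos (k i') ^ 2)
    (fun k => 1 * Real.cos (k i) ^ 2 + (-1) * (Real.cos (k i) ^ 2 * Real.cos (k i') ^ 2)) hm₁ hm₂ hb₁ hb₂,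
    srwTwist_lin₂ hd _ _ (fun _ => (1 : ℝ)) (fun k => Real.cos (k i') ^ 2) measurable_const hci' (W₁ := 1)
    (fun _ => by rw [abs_one]) (hbsq i'),
    srwTwist_lin₂ hd _ _ (fun k => Real.cos (k i) ^ 2) (fun k => Real.cos (k i) ^ 2 * Real.cos (k i') ^ 2) hci
    (hci.mul hci') (hbsq i) (W₂ := 1) (fun k => abs_cos_sq_mul_cos_sq_le (k i) (k i')),
    srwTwist_one_zero_eq hd i x, srwTwist_cos_sq_zero_eq hd i x, srwTwist_cos_sq_zero_eq hd i' x,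
    srwTwist_cos_sq_mul_cos_sq_zero_eq hd hii' x]
  ring

/-! ### Three-index classes (the pure `U_{n,2}` classes `[3,1]`, `[1,1,2]`) -/

/-- `|cos a cos b cos c| ≤ 1`. [folklore] -/
private theorem abs_cos_mul_cos_mul_cos_le (a b c : ℝ) : |Real.cos a * Real.cos b * Real.cos c| ≤ 1 := by
  rw [abs_mul]
  exact mul_le_one₀ (abs_cos_mul_cos_le a b) (abs_nonneg _) (Real.abs_cos_le_one _)

/-- `Π_j cos((a e_i + b e_{i'} + c e_{i''})_j k_j) = cos(a k_i) cos(b k_{i'}) cos(c k_{i''})` (pairwise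
distinct indices). [folklore] -/
private theorem prodCos_single_add_single_add_single {i i' i'' : Fin d} (hii' : i ≠ i') (hii'' : i ≠ i'')
    (hi'i'' : i' ≠ i'') (a b c : ℤ) (k : Fin d → ℝ) :
    ∏ j, Real.cos (((Pi.single i a + Pi.single i' b + Pi.single i'' c : Fin d → ℤ) j : ℝ) * k j)
      = Real.cos ((a : ℝ) * k i) * Real.cos ((b : ℝ) * k i') * Real.cos ((c : ℝ) * k i'') := by
  rw [← Finset.prod_erase_mul _ _ (mem_univ i''), Finset.prod_eq_mul i i' hii']
  · simp [Pi.add_apply, Pi.single_eq_same, Pi.single_eq_of_ne hii', Pi.single_eq_of_ne hii'.symm,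
      Pi.single_eq_of_ne hii'', Pi.single_eq_of_ne hii''.symm, Pi.single_eq_of_ne hi'i'',
      Pi.single_eq_of_ne hi'i''.symm]
  · intro c hc hc'
    have hc'' : c ≠ i'' := (Finset.mem_erase.mp hc).1
    simp [Pi.add_apply, Pi.single_eq_of_ne hc'.1, Pi.single_eq_of_ne hc'.2, Pi.single_eq_of_ne hc'']
  · intro h; exact absurd (Finset.mem_erase.mpr ⟨hii'', mem_univ _⟩) h
  · intro h; exact absurd (Finset.mem_erase.mpr ⟨hi'i'', mem_univ _⟩) h

/-- **Three-index class**: `Tw^{cos(a k_i) cos(b k_{i'}) cos(c k_{i''})}_n(x;0) = I_{n,0}(a e_i + b e_{i'} + c e_{i''})`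
(pairwise distinct indices, `d ≥ 2n+1`). [cite: FitznerVanDerHofstad2016NoBLE, (3.34)–(3.35) p. 1071] -/
theorem srwTwist_cos_mul_cos_mul_cos_intMul_zero_eq_srwI {n : ℕ} (hd : 2 * n + 1 ≤ d) {i i' i'' : Fin d}
    (hii' : i ≠ i') (hii'' : i ≠ i'') (hi'i'' : i' ≠ i'') (a b c : ℤ) (x : Fin d → ℤ) :
    srwTwist d n (fun k => Real.cos ((a : ℝ) * k i) * Real.cos ((b : ℝ) * k i') * Real.cos ((c : ℝ) * k i''))
        x 0
      = srwI d n 0 (Pi.single i a + Pi.single i' b + Pi.single i'' c) := by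
  have h := srwTwist_prodCos_zero_eq_srwI hd (Pi.single i a + Pi.single i' b + Pi.single i'' c) x
  simp_rw [prodCos_single_add_single_add_single hii' hii'' hi'i''] at h
  exact h

/-- **`[3,1]`-power class**: `Tw^{cos³ k_i cos k_{i'}}_n(x;0) = (3 I_{n,0}(e_i + e_{i'}) + I_{n,0}(3e_i + e_{i'}))/4`
(`i ≠ i'`, `d ≥ 2n+1`; a pure class of the `U_{n,2}` weight `|D̂|² D̂^{sin}`).
[cite: FitznerVanDerHofstad2016NoBLE, (3.34)–(3.35) p. 1071, §5.2 (5.14) p. 1092] -/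
theorem srwTwist_cos_pow_three_mul_cos_zero_eq {n : ℕ} (hd : 2 * n + 1 ≤ d) {i i' : Fin d}
    (hii' : i ≠ i') (x : Fin d → ℤ) :
    srwTwist d n (fun k => Real.cos (k i) ^ 3 * Real.cos (k i')) x 0
      = (3 * srwI d n 0 (Pi.single i 1 + Pi.single i' 1)
          + srwI d n 0 (Pi.single i 3 + Pi.single i' 1)) / 4 := by
  have hw : (fun k : Fin d → ℝ => Real.cos (k i) ^ 3 * Real.cos (k i'))
      = fun k => 3 / 4 * (Real.cos ((1 : ℝ) * k i) * Real.cos ((1 : ℝ) * k i'))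
          + 1 / 4 * (Real.cos ((3 : ℝ) * k i) * Real.cos ((1 : ℝ) * k i')) := by
    funext k; rw [Real.cos_three_mul]; simp only [one_mul]; ring
  have h11 := srwTwist_cos_mul_cos_intMul_zero_eq_srwI hd hii' 1 1 x
  have h31 := srwTwist_cos_mul_cos_intMul_zero_eq_srwI hd hii' 3 1 x
  simp only [Int.cast_ofNat, Int.cast_one] at h11 h31
  rw [hw, srwTwist_lin₂ hd _ _ (fun k => Real.cos ((1 : ℝ) * k i) * Real.cos ((1 : ℝ) * k i'))
    (fun k => Real.cos ((3 : ℝ) * k i) * Real.cos ((1 : ℝ) * k i'))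
    ((measurable_cos_cmul 1 i).mul (measurable_cos_cmul 1 i'))
    ((measurable_cos_cmul 3 i).mul (measurable_cos_cmul 1 i')) (W₁ := 1) (W₂ := 1)
    (fun _ => abs_cos_mul_cos_le _ _) (fun _ => abs_cos_mul_cos_le _ _), h11, h31]
  ring

/-- **`[1,1,2]`-power class**: `Tw^{cos k_i cos k_{i'} cos² k_{i''}}_n(x;0) = (I_{n,0}(e_i + e_{i'}) + I_{n,0}(e_i + e_{i'} + 2e_{i''}))/2`
(pairwise distinct indices, `d ≥ 2n+1`; the three-index pure class of the `U_{n,2}` weight).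
[cite: FitznerVanDerHofstad2016NoBLE, (3.34)–(3.35) p. 1071, §5.2 (5.14) p. 1092] -/
theorem srwTwist_cos_mul_cos_mul_cos_sq_zero_eq {n : ℕ} (hd : 2 * n + 1 ≤ d) {i i' i'' : Fin d}
    (hii' : i ≠ i') (hii'' : i ≠ i'') (hi'i'' : i' ≠ i'') (x : Fin d → ℤ) :
    srwTwist d n (fun k => Real.cos (k i) * Real.cos (k i') * Real.cos (k i'') ^ 2) x 0
      = (srwI d n 0 (Pi.single i 1 + Pi.single i' 1)
          + srwI d n 0 (Pi.single i 1 + Pi.single i' 1 + Pi.single i'' 2)) / 2 := by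
  have hw : (fun k : Fin d → ℝ => Real.cos (k i) * Real.cos (k i') * Real.cos (k i'') ^ 2)
      = fun k => 1 / 2 * (Real.cos ((1 : ℝ) * k i) * Real.cos ((1 : ℝ) * k i'))
          + 1 / 2 * (Real.cos ((1 : ℝ) * k i) * Real.cos ((1 : ℝ) * k i') * Real.cos ((2 : ℝ) * k i'')) := by
    funext k; rw [Real.cos_sq]; simp only [one_mul]; ring
  have h11 := srwTwist_cos_mul_cos_intMul_zero_eq_srwI hd hii' 1 1 x
  have h112 := srwTwist_cos_mul_cos_mul_cos_intMul_zero_eq_srwI hd hii' hii'' hi'i'' 1 1 2 x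
  simp only [Int.cast_ofNat, Int.cast_one] at h11 h112
  rw [hw, srwTwist_lin₂ hd _ _ (fun k => Real.cos ((1 : ℝ) * k i) * Real.cos ((1 : ℝ) * k i'))
    (fun k => Real.cos ((1 : ℝ) * k i) * Real.cos ((1 : ℝ) * k i') * Real.cos ((2 : ℝ) * k i''))
    ((measurable_cos_cmul 1 i).mul (measurable_cos_cmul 1 i'))
    (((measurable_cos_cmul 1 i).mul (measurable_cos_cmul 1 i')).mul (measurable_cos_cmul 2 i''))
    (W₁ := 1) (W₂ := 1) (fun _ => abs_cos_mul_cos_le _ _) (fun _ => abs_cos_mul_cos_mul_cos_le _ _ _),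
    h11, h112]
  ring

end Literature.Probability.FitznerVanDerHofstad2017
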